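import Summits.Parity.BatemanHorn.Theses.SelbergDelangeRigidity
import Summits.Parity.BatemanHorn.Theorems.SystemLSDRealSegment.Negative.OmegaWide

/-!
# `NormalFamilyBound` — negative lemmas I: the family on the real axis, witness systems

Support (negative side) for crux `stmt-Parity-9769`
(`Summit.Parity.BatemanHorn.Theses.SelbergDelangeRigidity.NormalFamilyBound`, route SelbergDelangeRigidity):
the family `H_x(z) = x⁻¹ (log x)^{k(1−z)} Σ_{n ≤ x} z^{Ω_f(n)}` must be locally bounded on a thin rectangle
`V_η = {−η < Re z < 7/4, |Im z| < η}` for every Bateman–Horn system `f`.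

* `normalFamilyBound_iff` — the crux in the vocabulary `V`, `H`, `locallyBoundedSystems` (definitional);
* `not_mem_locallyBoundedSystems_of_unbounded` — ONE real point `a ∈ [0, R)` with `sup_x ‖H_x(a)‖ = ∞`
  excludes `f` for every `η` (all witnesses are real points, where the weights `a^{Ω_f(n)} ≥ 0` cannot
  cancel: `norm_H_ofReal`);
* `empty_mem_locallyBoundedSystems` — the `k = 0` instance is true (`H_x ≡ (x+1)/x`);
* witness systems `(1)`, `(X²)`, `(−X)`, `(2)`, `(X, X)`, `(X)` with their `Ω_f` and `ω_f(p) < p`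
  (`isBatemanHornSystem_fX`: `(X)` is a genuine Bateman–Horn system, reused from
  `SystemLSDRealSegment/Negative/OmegaWide.lean`) — consumed by
  `Negative/LoadBearing.lean` (the `_false_without_` theorems and the tightness of the radius `2`).

Standing disprover's work file: `Summits/Parity/BatemanHorn/Cruxes/NormalFamilyBound/Disproof.lean`.
-/

namespace Summit.Parity.BatemanHorn.Theorems.NormalFamilyBound.Negative

open Literature.NumberTheory.Sieve Polynomial Finset Filter
open Summit.Parity.BatemanHorn.Theses.SelbergDelangeRigidity
open Summit.Parity.BatemanHorn.Theorems.SystemLSDRealSegment.Negative (tendsto_loglog_atTop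
  isBatemanHornSystem_X polyRootCountMod_X)

noncomputable section

/-! ## The objects of the crux, named -/

/-- The thin rectangle `V_{R,η} = {−η < Re z < R, |Im z| < η}`; the crux uses `R = 7/4`. [folklore] -/
def V (R η : ℝ) : Set ℂ := {z : ℂ | -η < z.re ∧ z.re < R ∧ |z.im| < η}

/-- `Ω_f(n) = Σ_i Ω((f_i(n)).toNat)` exactly as in the crux (junk conventions: `toNat` of a negative
value is `0`, `Ω 0 = Ω 1 = 0`). [folklore] -/
def Ωf {k : ℕ} (f : Fin k → ℤ[X]) (n : ℕ) : ℕ :=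
  ∑ i, ArithmeticFunction.cardFactors (((f i).eval (n : ℤ)).toNat)

/-- The normalised family `H_x(z) = x⁻¹ (log x)^{k(1−z)} Σ_{n ≤ x} z^{Ω_f(n)}` exactly as in the crux. [folklore] -/
def H (k : ℕ) (f : Fin k → ℤ[X]) (x : ℕ) (z : ℂ) : ℂ :=
  (x : ℂ)⁻¹ * Complex.exp ((k : ℂ) * (1 - z) * (Real.log (Real.log x) : ℂ)) *
    ∑ n ∈ Finset.range (x + 1), z ^ (∑ i, ArithmeticFunction.cardFactors (((f i).eval (n : ℤ)).toNat))

/-- The systems `f` whose family `{H_x}_x` is locally bounded on `V_{R,η}` for some `η ∈ (0, 1/4]`, ball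
form (the crux: `R = 7/4`, all Bateman–Horn systems belong). [folklore] -/
def locallyBoundedSystems (R : ℝ) (k : ℕ) : Set (Fin k → ℤ[X]) :=
  {f | ∃ η : ℝ, 0 < η ∧ η ≤ 1 / 4 ∧ ∀ a ∈ V R η, ∃ M : ℝ, ∃ r > (0 : ℝ), ∀ x : ℕ,
    ∀ z ∈ Metric.ball a r ∩ V R η, ‖H k f x z‖ ≤ M}

/-- The crux, unfolded (definitional): every Bateman–Horn system lies in `locallyBoundedSystems (7/4) k`.
[folklore] -/
theorem normalFamilyBound_iff :
    NormalFamilyBound ↔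
      ∀ (k : ℕ) (f : Fin k → ℤ[X]), IsBatemanHornSystem f → f ∈ locallyBoundedSystems (7 / 4) k :=
  Iff.rfl

/-! ## Reduction to one real point -/

/-- REDUCTION. A real point `a ∈ [0, R)` lies in every `V_{R,η}` and in every ball about itself, so
if `x ↦ ‖H_x(a)‖` is unbounded then the family is locally bounded on NO `V_{R,η}`: this is how every
witness below is used (no complex analysis; the prover's freedom to choose η is worthless against a
real-axis blow-up). [folklore] -/
theorem not_mem_locallyBoundedSystems_of_unbounded {R : ℝ} {k : ℕ} {f : Fin k → ℤ[X]} (a : ℝ)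
    (ha0 : 0 ≤ a) (ha1 : a < R) (h : ∀ M : ℝ, ∃ x : ℕ, M < ‖H k f x a‖) :
    f ∉ locallyBoundedSystems R k := by
  rintro ⟨η, hη, -, hB⟩
  have haV : (a : ℂ) ∈ V R η := by
    refine ⟨?_, ?_, ?_⟩ <;> simp <;> linarith
  obtain ⟨M, r, hr, hM⟩ := hB a haV
  obtain ⟨x, hx⟩ := h M
  have := hM x a ⟨Metric.mem_ball_self hr, haV⟩
  linarith

/-- Unboundedness from a divergent minorant along a subsequence. [folklore] -/
theorem unbounded_of_tendsto {k : ℕ} {f : Fin k → ℤ[X]} {a : ℝ} (g : ℕ → ℝ) (xs : ℕ → ℕ)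
    (hg : Tendsto g atTop atTop) (hle : ∀ᶠ m in atTop, g m ≤ ‖H k f (xs m) a‖) :
    ∀ M : ℝ, ∃ x : ℕ, M < ‖H k f x a‖ := by
  intro M
  obtain ⟨m, hm⟩ := ((tendsto_atTop_mono' atTop hle hg).eventually_gt_atTop M).exists
  exact ⟨xs m, hm⟩

/-- On the real axis the family is real: `H_x(a) = x⁻¹ · exp(k(1−a)·log log x) · Σ_n a^{Ω_f(n)}`. [folklore] -/
theorem H_ofReal (k : ℕ) (f : Fin k → ℤ[X]) (x : ℕ) (a : ℝ) :
    H k f x a = ((x : ℝ)⁻¹ * Real.exp (k * (1 - a) * Real.log (Real.log x)) *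
      ∑ n ∈ Finset.range (x + 1), a ^ Ωf f n : ℝ) := by
  simp only [H, Ωf]
  push_cast
  ring

/-- Norm of the family at a real point `a ≥ 0` (all terms nonnegative: no cancellation can help). [folklore] -/
theorem norm_H_ofReal (k : ℕ) (f : Fin k → ℤ[X]) (x : ℕ) {a : ℝ} (ha : 0 ≤ a) :
    ‖H k f x a‖ = (x : ℝ)⁻¹ * Real.exp (k * (1 - a) * Real.log (Real.log x)) *
      ∑ n ∈ Finset.range (x + 1), a ^ Ωf f n := by
  rw [H_ofReal, Complex.norm_real, Real.norm_eq_abs, abs_of_nonneg]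
  have : 0 ≤ ∑ n ∈ Finset.range (x + 1), a ^ Ωf f n := sum_nonneg fun n _ => pow_nonneg ha _
  positivity

/-- `q^m / m^s → ∞` for `q > 1`. [folklore] -/
theorem tendsto_geom_div_pow {q : ℝ} (hq : 1 < q) (s : ℕ) :
    Tendsto (fun m : ℕ => q ^ m / (m : ℝ) ^ s) atTop atTop := by
  have h := (tendsto_exp_mul_div_rpow_atTop s (Real.log q) (Real.log_pos hq)).comp
    tendsto_natCast_atTop_atTop
  refine h.congr' (Eventually.of_forall fun m => ?_)
  simp only [Function.comp, Real.rpow_natCast]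
  rw [mul_comm, Real.exp_nat_mul, Real.exp_log (by linarith)]

/-- For `x = 2^m`, `log x = m log 2`. [folklore] -/
theorem log_two_pow (m : ℕ) : Real.log ((2 ^ m : ℕ) : ℝ) = m * Real.log 2 := by
  push_cast
  exact Real.log_pow 2 m

/-- `m log 2 ≥ 1` for `m ≥ 2`. [folklore] -/
theorem one_le_mul_log_two {m : ℕ} (hm : 2 ≤ m) : 1 ≤ (m : ℝ) * Real.log 2 := by
  have h2 : (2 : ℝ) ≤ m := by exact_mod_cast hm
  have := Real.log_two_gt_d9
  nlinarith

/-! ## k = 0: the empty system (sanity; TRUE) -/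

/-- For the empty system `H_x(z) = (x+1)/x` (and `0` at `x = 0`), bounded by `2`: the crux holds at
`k = 0` for the trivial reason. (Positive instance; information only.) [folklore] -/
theorem empty_mem_locallyBoundedSystems (R : ℝ) (f : Fin 0 → ℤ[X]) : f ∈ locallyBoundedSystems R 0 := by
  refine ⟨1 / 4, by norm_num, le_rfl, fun a _ => ⟨2, 1, one_pos, fun x z _ => ?_⟩⟩
  have hH : H 0 f x z = (x : ℂ)⁻¹ * (x + 1 : ℕ) := by
    simp [H]
  rw [hH, norm_mul, norm_inv, Complex.norm_natCast, Complex.norm_natCast]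
  rcases Nat.eq_zero_or_pos x with rfl | hx
  · simp
  · have hx' : (0 : ℝ) < x := by exact_mod_cast hx
    rw [inv_mul_le_iff₀ hx']
    push_cast
    have : (1 : ℝ) ≤ x := by exact_mod_cast hx
    linarith

/-! ## Witness systems (for `Negative/LoadBearing.lean`) -/

/-- `(1)`: the constant unit polynomial (not irreducible). [folklore] -/
def fOne : Fin 1 → ℤ[X] := ![C 1]
/-- `(X²)`: non-constant, reducible. [folklore] -/
def fXsq : Fin 1 → ℤ[X] := ![X ^ 2]
/-- `(−X)`: irreducible with negative leading coefficient. [folklore] -/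
def fNegX : Fin 1 → ℤ[X] := ![-X]
/-- `(2)`: the prime constant, irreducible in `ℤ[X]`, fixed prime divisor `2`. [folklore] -/
def fTwo : Fin 1 → ℤ[X] := ![C 2]
/-- `(X, X)`: two associated components. [folklore] -/
def fXX : Fin 2 → ℤ[X] := ![X, X]
/-- `(X)`: the integers themselves — a genuine Bateman–Horn system (the known case of the crux). [folklore] -/
def fX : Fin 1 → ℤ[X] := ![X]

/-- `Ω_{(1)} ≡ 0`. [folklore] -/
theorem Ωf_fOne (n : ℕ) : Ωf fOne n = 0 := by simp [Ωf, fOne]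
/-- `Ω_{(−X)} ≡ 0` (`toNat (−n) = 0`). [folklore] -/
theorem Ωf_fNegX (n : ℕ) : Ωf fNegX n = 0 := by simp [Ωf, fNegX]
/-- `Ω_{(2)} ≡ 1`. [folklore] -/
theorem Ωf_fTwo (n : ℕ) : Ωf fTwo n = 1 := by
  simp [Ωf, fTwo, ArithmeticFunction.cardFactors_apply_prime Nat.prime_two]
/-- `Ω_{(X,X)}(n) = 2Ω(n)`. [folklore] -/
theorem Ωf_fXX (n : ℕ) : Ωf fXX n = 2 * ArithmeticFunction.cardFactors n := by
  simp [Ωf, fXX, Fin.sum_univ_two]; ring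
/-- `Ω_{(X²)}(n) = 2Ω(n)`. [folklore] -/
theorem Ωf_fXsq (n : ℕ) : Ωf fXsq n = 2 * ArithmeticFunction.cardFactors n := by
  simp [Ωf, fXsq]
  rw [show ((n : ℤ) ^ 2).toNat = n ^ 2 by exact_mod_cast Int.toNat_natCast (n ^ 2)]
  rw [ArithmeticFunction.cardFactors_pow]
/-- `Ω_{(X)}(n) = Ω(n)`. [folklore] -/
theorem Ωf_fX (n : ℕ) : Ωf fX n = ArithmeticFunction.cardFactors n := by simp [Ωf, fX]

/-- `ω_{(X)}(p) = 1`: only `n ≡ 0`. [folklore] -/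
theorem card_filter_dvd_range {p : ℕ} (hp : p.Prime) :
    #((range p).filter fun n : ℕ ↦ (p : ℤ) ∣ (n : ℤ)) = 1 := by
  rw [show (range p).filter (fun n : ℕ ↦ (p : ℤ) ∣ (n : ℤ)) = {0} from ?_]
  · simp
  ext n
  simp only [mem_filter, mem_range, mem_singleton, Int.natCast_dvd_natCast]
  constructor
  · rintro ⟨hn, hdvd⟩; exact Nat.eq_zero_of_dvd_of_lt hdvd hn
  · rintro rfl; exact ⟨hp.pos, dvd_zero p⟩

/-- `(−X)` has no fixed prime divisor. [folklore] -/
theorem hasNoFixedPrimeDivisor_fNegX : HasNoFixedPrimeDivisor fNegX := fun p hp => by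
  simp only [polyRootCountMod, fNegX, Fin.prod_univ_one, Matrix.cons_val_fin_one, eval_neg, eval_X,
    dvd_neg]
  rw [card_filter_dvd_range hp]; exact hp.one_lt

/-- `(1)` has no fixed prime divisor (`ω ≡ 0`). [folklore] -/
theorem hasNoFixedPrimeDivisor_fOne : HasNoFixedPrimeDivisor fOne := fun p hp => by
  simp only [polyRootCountMod, fOne, Fin.prod_univ_one, Matrix.cons_val_fin_one, eval_C]
  rw [Finset.filter_false_of_mem]
  · simp [hp.pos]
  · intro n _ h
    have := Int.eq_one_of_dvd_one (by positivity) h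
    have := hp.one_lt
    omega

/-- `p ∣ n²` iff `p ∣ n` on `range p`. [folklore] -/
theorem sq_filter_eq {p : ℕ} (hp : p.Prime) :
    (range p).filter (fun n : ℕ ↦ (p : ℤ) ∣ (n : ℤ) * (n : ℤ)) =
      (range p).filter fun n : ℕ ↦ (p : ℤ) ∣ (n : ℤ) := by
  have hpZ : Prime (p : ℤ) := Nat.prime_iff_prime_int.mp hp
  ext n
  simp only [mem_filter, and_congr_right_iff]
  intro _
  constructor
  · intro h; rcases hpZ.dvd_or_dvd h with h | h <;> exact h
  · intro h; exact dvd_mul_of_dvd_left h _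

/-- `(X, X)` has no fixed prime divisor. [folklore] -/
theorem hasNoFixedPrimeDivisor_fXX : HasNoFixedPrimeDivisor fXX := fun p hp => by
  simp only [polyRootCountMod, fXX, Fin.prod_univ_two, Matrix.cons_val_zero, Matrix.cons_val_one,
    eval_X]
  rw [sq_filter_eq hp, card_filter_dvd_range hp]; exact hp.one_lt

/-- `(X²)` has no fixed prime divisor. [folklore] -/
theorem hasNoFixedPrimeDivisor_fXsq : HasNoFixedPrimeDivisor fXsq := fun p hp => by
  simp only [polyRootCountMod, fXsq, Fin.prod_univ_one, Matrix.cons_val_fin_one, eval_pow, eval_X]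
  simp only [sq]
  rw [sq_filter_eq hp, card_filter_dvd_range hp]; exact hp.one_lt

/-- `(X)` IS a Bateman–Horn system (= `SystemLSDRealSegment.Negative.isBatemanHornSystem_X`). [folklore] -/
theorem isBatemanHornSystem_fX : IsBatemanHornSystem fX := isBatemanHornSystem_X

end

end Summit.Parity.BatemanHorn.Theorems.NormalFamilyBound.Negative
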